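import Summits.HodgeConjecture.HodgeConjecture.Theorems.F0P3cStCharTSUpTrU2Chart   -- (B1) LH7-p02 (g8) «U2-CHART»: `exists_upper ∕ exists_lower ∕ exists_diag`, `mem_unitaryGroupOfForm_two_iff`, `coe_eq_diag_of_mem_torusU`, `map_entry_mul_entry_eq_one_of_mem_torusU`
import Literature.NumberTheory.Automorphic.GLnCongruenceSubgroups                   -- ★ `congruenceGL`, `mem_congruenceGL_iff`, `ValBound`
import Literature.Topology.UltrametricIsometrySurjective                            -- ★ (B3) LH6-p03 (g6) p852379 + ED. 2: `surjOn_of_isCompact_of_valuation_sub_eq`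
import Mathlib.NumberTheory.LocalField.Basic                                         -- `IsNonarchimedeanLocalField.isCompact_closedBall`
import HarnessLib

/-!
# F0 · P3c · line LH6 «StCharTS» — ROAD «UP-TR» brick (H4s), sub-road «JAC-LOC₂» file (B6) «ORBIT-TUBE₂ ⊇»: every point of the big cell
# `ū(Z) · t · u(Y)` with `|Z|, |Y| ≤ γ·|a(t)⁻¹ − 1|` is a `K_γ`-conjugate of a point of the torus coset `t · M_γ`, for a REGULAR diagonal `t` of the
# quasi-split `U(1,1) = U(σ, Φ₂)(K)` over a non-archimedean local field — by TWO EXACT CONJUGATIONS (Harish-Chandra 1970 Lemma 22, rank one, no Newton iteration)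

Cell `pub/hodgecm-mathlib`, crux H413 = `stmt-HodgeConjecture-24833` (lane `--supports … --as helper`), route HCCMUnconditional; seat LH7-p03 (g6), brick (B6) of the
sub-road «JAC-LOC₂» (sub-dealer LH7-p02 (g8), memo `F0/P3c/LH7/LH7-p02/g8/h4s/ROAD-JAC-LOC2.v1.LH7p02g8.md` §2–§3; DEAL #3 2026-09-02T18:39:41Z) of ROAD «UP-TR»
(holder F0P3-p02 (g23)).  THEOREMS ONLY; sorry-free; no definition ∕ instance ∕ notation ∕ named fact; axioms TRIO.

THE MATHEMATICS.  `U′ = U(σ, Φ₂)(K)`, `K` a non-archimedean local field, `σ` a continuous involution with fixed field `F`, `K⁻ = {x | σ x = −x}`; (B1) notation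
`u(y) = !![1, y; 0, 1]`, `ū(z) = !![1, 0; z, 1]` (`y, z ∈ K⁻`), `t = !![e₀, 0; 0, e₁] ∈ M` (`σe₀·e₁ = 1`), root value `a(t) = e₀ σe₀ = e₀∕e₁ ∈ F` (`t⁻¹ u(y) t = u(a⁻¹ y)`,
`t⁻¹ ū(z) t = ū(a z)`), levels `K_γ = congruenceGL 2 γ`.  TARGET `g = ū(Z) · t · u(Y)`, `t` REGULAR (`a ≠ 1`), `|Z|, |Y| ≤ γ·|a⁻¹ − 1|`, `γ < 1`, `γ·|a⁻¹ − 1| ≤ 1`.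
CLAIM (`exists_conj_eq_lower_mul_torus_mul_upper`): `∃ k ∈ K_γ ∩ U′`, `∃ τ ∈ M ∩ K_γ`, `k · (t τ) · k⁻¹ = g`.  STEP 1 (kill the `N̄`-coordinate by `ū(z)`, `|z| ≤ γ`):
`ū(z)⁻¹ g ū(z) = ū(Z − z) · t · [u(Y) ū(z)]`, `u(Y) ū(z) = ū(z∕β) · m(β, β⁻¹) · u(Y∕β)`, `β := 1 + Y z ∈ F`, so the `N̄`-coordinate of `ū(z)⁻¹ g ū(z)` is
`Z − z + z∕(aβ)`, which vanishes iff `c z + Y z² = Z`, `c := 1 − a⁻¹ − Z Y ∈ F`, `|c| = |a⁻¹ − 1|` — ONE scalar equation on `K⁻`, solved EXACTLY (`exists_skew_root`) by ★ (B3)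
`surjOn_of_isCompact_of_valuation_sub_eq`: `G(x) := x + (Y∕c) x²` is a valuation-isometry of the compact `S := {x ∈ K⁻ : |x| ≤ γ}` into itself, hence onto, and
`|Z∕c| ≤ γ`.  STEP 2 (kill the `N`-coordinate by `u(y)`): with `t₂ := t · m(β, β⁻¹)`, `a₂ = a β²`, `u(y)⁻¹ (t₂ u(Y∕β)) u(y) = t₂ u(Y∕β + (1 − a₂⁻¹) y)` and
`|a₂⁻¹ − 1| = |a⁻¹ − 1|` (`|β² − 1| ≤ γ²|a⁻¹ − 1|`), so `y := (Y∕β)∕(a₂⁻¹ − 1) ∈ K⁻`, `|y| ≤ γ`; `k := ū(z) u(y) ∈ K_γ`, `τ := m(β, β⁻¹) ∈ M ∩ K_γ`, and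
`k (t τ) k⁻¹ = g` is ONE `2 × 2` identity over a field (`lower_upper_conj_diag_eq`).  §5 restates it in the letters of (B5) «ORBIT-TUBE₂ ⊆» for the base point `s`
of the tube: `s · (n̄ m n) ∈ Ad(K_γ)(s · M_γ)` for `n̄ ∈ N̄[γ|a−1|]`, `m ∈ M_γ`, `n ∈ N[γ|a⁻¹−1|]`, i.e. `s · P_s ⊆ Ad(K_γ)(s · M_γ)` — the consumer is (B7) «MODEL-SOCKET₂».
HONEST LABEL: count-neutral for ROAD «UP-TR» (the hyperbolic `H`-side tube Jacobian); closes no organ.  HC_CM is proved only modulo the 7 printed citations (2 remaining: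
hLiu418 = `stmt-HodgeConjecture-24832`, h413 = `stmt-HodgeConjecture-24833`) until rung 0 closes.

## References
* [HarishChandra1970] Harish-Chandra (notes by G. van Dijk), *Harmonic analysis on reductive `p`-adic groups*, LNM 162 (1970), Part V §4, Lemma 22 (the orbit of a
  compact open subgroup through a regular point of a split torus coset).
* [Casselman1995] W. Casselman, *Introduction to the theory of admissible representations of `p`-adic reductive groups* (1995 notes), Prop. 1.4.4 (Iwahori factorisation).
* [Rogawski1990] J. D. Rogawski, *Automorphic Representations of Unitary Groups in Three Variables*, Ann. of Math. Stud. 123 (1990), §1.10 p. 9, §12.5 p. 182.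
* [Schikhof1984] W. H. Schikhof, *Ultrametric Calculus*, Cambridge (1984), §27 (a self-isometry of a compact ultrametric space is onto).
-/

set_option autoImplicit false
-- the mandated namespace has the single-problem summit's repeated segment (`HodgeConjecture.HodgeConjecture`)
set_option linter.dupNamespace false

open Matrix Set ValuativeRel
open Literature.NumberTheory.Automorphic Literature.NumberTheory.Automorphic.UnitaryGroup
open Summit.HodgeConjecture.HodgeConjecture.Cruxes.H413.F0P3cStCharTSUpTrU2Chart
open scoped MatrixGroups

namespace Summit.HodgeConjecture.HodgeConjecture.Cruxes.H413.F0P3cStCharTSUpTrU2OrbitSurj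

/-! ## §1 The `2 × 2` identity behind the two conjugations (any field) -/

section Identity

variable {R : Type*} [Field R]

/-- **THE TWO-STEP CONJUGATION IDENTITY.**  With `β = 1 + Y z ≠ 0`, `e₀ ≠ 0`, `e₁ − e₀β² ≠ 0` and the solved coordinates
`y = Y e₀ β ∕ (e₁ − e₀ β²)`, `Z = ((e₀ − e₁) z + e₀ Y z²) ∕ (e₀ β)`:
`ū(z) · u(y) · m(e₀β, e₁β⁻¹) · u(−y) · ū(−z) = ū(Z) · m(e₀, e₁) · u(Y)`. [cite: HarishChandra1970, Lemma 22] [cite: Casselman1995, Prop. 1.4.4] -/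
theorem lower_upper_conj_diag_eq (Y z y Z e₀ e₁ β : R) (hβ : β = 1 + Y * z) (hβ0 : β ≠ 0) (he₀ : e₀ ≠ 0) (hE : e₁ - e₀ * β ^ 2 ≠ 0)
    (hy : y = Y * e₀ * β / (e₁ - e₀ * β ^ 2)) (hZ : Z = ((e₀ - e₁) * z + e₀ * Y * z ^ 2) / (e₀ * β)) :
    (!![1, 0; z, 1] : Matrix (Fin 2) (Fin 2) R) * !![1, y; 0, 1] * !![e₀ * β, 0; 0, e₁ * β⁻¹] * (!![1, -y; 0, 1] * !![1, 0; -z, 1]) =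
      !![1, 0; Z, 1] * !![e₀, 0; 0, e₁] * !![1, Y; 0, 1] := by
  subst hy hZ
  ext i j
  fin_cases i <;> fin_cases j <;> simp [Matrix.mul_apply, Fin.sum_univ_two] <;> field_simp <;> subst hβ <;> ring

end Identity

/-! ## §2 The scalar equation on the skew line (non-archimedean local field) -/

section Scalar

variable {K : Type*} [Field K] [ValuativeRel K] [TopologicalSpace K] [IsNonarchimedeanLocalField K] (σ : K →+* K)

omit [TopologicalSpace K] [IsNonarchimedeanLocalField K] in
/-- `v(1 + x) = 1` and `1 + x ≠ 0` for `v x < 1`. [cite: Schikhof1984, §27] -/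
theorem valuation_one_add_eq_one {x : K} (hx : valuation K x < 1) : valuation K (1 + x) = 1 ∧ 1 + x ≠ 0 := by
  have h := Valuation.map_one_add_of_lt (valuation K) hx
  refine ⟨h, fun h0 => ?_⟩
  rw [h0, Valuation.map_zero] at h
  exact zero_ne_one h

/-- **THE SCALAR EQUATION `c z + Y z² = Z` HAS A SKEW SOLUTION OF SIZE `≤ γ`** when `c ∈ F^×`, `Y, Z ∈ K⁻`, `|Y| ≤ γ|c|`, `|Z| ≤ γ|c|`, `γ < 1`:
the map `G(x) = x + (Y∕c) x²` is a valuation-isometry of the compact set `S = {x ∈ K⁻ : |x| ≤ γ}` into itself, hence onto (★ `surjOn_of_isCompact_of_valuation_sub_eq`),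
and `Z∕c ∈ S`. [cite: Schikhof1984, §27] [cite: HarishChandra1970, Lemma 22] -/
theorem exists_skew_root (hσc : Continuous σ) {γ : ValueGroupWithZero K} (hγ1 : γ < 1) {c Y Z : K} (hc0 : c ≠ 0) (hcσ : σ c = c)
    (hYσ : σ Y = -Y) (hZσ : σ Z = -Z) (hY : valuation K Y ≤ γ * valuation K c) (hZ : valuation K Z ≤ γ * valuation K c) :
    ∃ z : K, σ z = -z ∧ valuation K z ≤ γ ∧ c * z + Y * z ^ 2 = Z := by
  have hvc : 0 < valuation K c := zero_lt_iff.2 ((Valuation.ne_zero_iff _).2 hc0)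
  have hγ1' : γ ≤ 1 := hγ1.le
  set S : Set K := {x | σ x = -x ∧ valuation K x ≤ γ} with hS
  have hScpt : IsCompact S := by
    haveI : T2Space K := (Literature.NumberTheory.GaloisRepresentations.IsNonarchimedeanLocalField.isLocalField K).toT2Space
    have hclosed : IsClosed {x : K | σ x = -x} := isClosed_eq hσc continuous_neg
    have : S = {x : K | σ x = -x} ∩ {x | valuation K x ≤ γ} := by ext x; simp [hS]
    rw [this]
    exact (IsNonarchimedeanLocalField.isCompact_closedBall K γ).inter_left hclosed
  have hYc : valuation K (Y / c) ≤ γ := by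
    rw [map_div₀, div_le_iff₀ hvc]; exact hY
  have hZc : valuation K (Z / c) ≤ γ := by
    rw [map_div₀, div_le_iff₀ hvc]; exact hZ
  have hYcσ : σ (Y / c) = -(Y / c) := by rw [map_div₀, hYσ, hcσ, neg_div]
  set G : K → K := fun x => x + Y / c * x ^ 2 with hG
  have hmaps : MapsTo G S S := by
    intro x hx
    obtain ⟨hxσ, hxv⟩ := hx
    refine ⟨?_, ?_⟩
    · show σ (x + Y / c * x ^ 2) = -(x + Y / c * x ^ 2)
      rw [map_add, map_mul, map_pow, hxσ, hYcσ, neg_sq]; ring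
    · show valuation K (x + Y / c * x ^ 2) ≤ γ
      refine le_trans (Valuation.map_add _ _ _) (max_le hxv ?_)
      rw [map_mul, map_pow]
      calc valuation K (Y / c) * valuation K x ^ 2 ≤ γ * γ ^ 2 := mul_le_mul' hYc (pow_le_pow_left' hxv 2)
        _ ≤ γ * 1 := mul_le_mul' le_rfl (pow_le_one₀ zero_le hγ1')
        _ = γ := mul_one γ
  have hiso : ∀ x₁ ∈ S, ∀ x₂ ∈ S, valuation K (G x₁ - G x₂) = valuation K (x₁ - x₂) := by
    intro x₁ hx₁ x₂ hx₂
    have hfac : G x₁ - G x₂ = (x₁ - x₂) * (1 + Y / c * (x₁ + x₂)) := by simp only [hG]; ring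
    have hsmall : valuation K (Y / c * (x₁ + x₂)) < 1 := by
      rw [map_mul]
      calc valuation K (Y / c) * valuation K (x₁ + x₂) ≤ γ * γ :=
            mul_le_mul' hYc (le_trans (Valuation.map_add _ _ _) (max_le hx₁.2 hx₂.2))
        _ < 1 := mul_lt_one_of_nonneg_of_lt_one_left zero_le hγ1 hγ1'
    rw [hfac, map_mul, (valuation_one_add_eq_one hsmall).1, mul_one]
  have hsurj := Literature.Topology.surjOn_of_isCompact_of_valuation_sub_eq hScpt hmaps hiso
  have htarget : Z / c ∈ S := ⟨by rw [map_div₀, hZσ, hcσ, neg_div], hZc⟩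
  obtain ⟨z, hzS, hz⟩ := hsurj htarget
  refine ⟨z, hzS.1, hzS.2, ?_⟩
  have h := congrArg (fun w => c * w) hz
  simp only [hG] at h
  rw [mul_div_cancel₀ _ hc0] at h
  rw [← h]; field_simp

end Scalar

/-! ## §3 The levels `K_γ` at rank `2`: membership of `ū(z)`, `u(y)`, `m(d, e)` by entries -/

section Levels

variable {K : Type*} [Field K] [ValuativeRel K]

/-- `!![1, 0; z, 1]` with inverse `!![1, 0; −z, 1]` lies in `K_γ = congruenceGL 2 γ` when `|z| ≤ γ ≤ 1`. [cite: Casselman1995, Prop. 1.4.4] -/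
theorem lower_mem_congruenceGL {γ : ValueGroupWithZero K} (hγ : γ ≤ 1) {g : GL (Fin 2) K} {z : K} (hz : valuation K z ≤ γ)
    (hg : (g : Matrix (Fin 2) (Fin 2) K) = !![1, 0; z, 1]) (hgi : ((g⁻¹ : GL (Fin 2) K) : Matrix (Fin 2) (Fin 2) K) = !![1, 0; -z, 1]) :
    g ∈ congruenceGL 2 γ := by
  rw [mem_congruenceGL_iff, hg, hgi]
  refine ⟨⟨fun i j => ?_, fun i j => ?_⟩, fun i j => ?_, fun i j => ?_⟩ <;> fin_cases i <;> fin_cases j <;>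
    simp [Matrix.one_fin_two, hz.trans hγ, hz]

/-- `!![1, y; 0, 1]` with inverse `!![1, −y; 0, 1]` lies in `K_γ` when `|y| ≤ γ ≤ 1`. [cite: Casselman1995, Prop. 1.4.4] -/
theorem upper_mem_congruenceGL {γ : ValueGroupWithZero K} (hγ : γ ≤ 1) {g : GL (Fin 2) K} {y : K} (hy : valuation K y ≤ γ)
    (hg : (g : Matrix (Fin 2) (Fin 2) K) = !![1, y; 0, 1]) (hgi : ((g⁻¹ : GL (Fin 2) K) : Matrix (Fin 2) (Fin 2) K) = !![1, -y; 0, 1]) :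
    g ∈ congruenceGL 2 γ := by
  rw [mem_congruenceGL_iff, hg, hgi]
  refine ⟨⟨fun i j => ?_, fun i j => ?_⟩, fun i j => ?_, fun i j => ?_⟩ <;> fin_cases i <;> fin_cases j <;>
    simp [Matrix.one_fin_two, hy.trans hγ, hy]

/-- `!![d, 0; 0, e]` with inverse `!![d′, 0; 0, e′]` lies in `K_γ` when all four entries are integral and `|d − 1|, |e − 1|, |d′ − 1|, |e′ − 1| ≤ γ`.
[cite: Casselman1995, Prop. 1.4.4] -/
theorem diag_mem_congruenceGL {γ : ValueGroupWithZero K} {g : GL (Fin 2) K} {d e d' e' : K}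
    (hd : valuation K d ≤ 1) (he : valuation K e ≤ 1) (hd' : valuation K d' ≤ 1) (he' : valuation K e' ≤ 1)
    (hd1 : valuation K (d - 1) ≤ γ) (he1 : valuation K (e - 1) ≤ γ) (hd'1 : valuation K (d' - 1) ≤ γ) (he'1 : valuation K (e' - 1) ≤ γ)
    (hg : (g : Matrix (Fin 2) (Fin 2) K) = !![d, 0; 0, e]) (hgi : ((g⁻¹ : GL (Fin 2) K) : Matrix (Fin 2) (Fin 2) K) = !![d', 0; 0, e']) :
    g ∈ congruenceGL 2 γ := by
  rw [mem_congruenceGL_iff, hg, hgi]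
  refine ⟨⟨fun i j => ?_, fun i j => ?_⟩, fun i j => ?_, fun i j => ?_⟩ <;> fin_cases i <;> fin_cases j <;>
    simp [Matrix.one_fin_two, hd, he, hd', he', hd1, he1, hd'1, he'1]

end Levels

/-! ## §4 THE HEAD: two exact conjugations -/

section Main

variable {K : Type*} [Field K] [ValuativeRel K] [TopologicalSpace K] [IsNonarchimedeanLocalField K]
  (σ : K →+* K) {J : Matrix (Fin 2) (Fin 2) K} (hJ : J = (StdForm.antidiagonal 2).over K)

include hJ in
/-- **(B6) ORBIT-TUBE₂ «⊇» — THE HEAD.**  `U′ = U(σ, Φ₂)(K)`, `K` a non-archimedean local field, `σ` a continuous involution; `t ∈ M` diagonal and REGULAR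
(`a⁻¹ = σ(t₁₁)·t₁₁ ≠ 1`); `γ < 1` with `γ·|a⁻¹ − 1| ≤ 1`.  Then every `g = n̄ · t · n` with `n̄ = !![1, 0; Z, 1]`, `n = !![1, Y; 0, 1]` in `U′` and
`|Z|, |Y| ≤ γ·|a⁻¹ − 1|` is `k · (t τ) · k⁻¹` for some `k ∈ U′ ∩ K_γ` and some diagonal `τ ∈ M ∩ K_γ` (`K_γ = congruenceGL 2 γ`): `n̄ · t · n ∈ Ad(K_γ)(t · M_γ)`.
See the module docstring for the two conjugations; the scalar step is ★ (B3) `surjOn_of_isCompact_of_valuation_sub_eq`, the matrix step is `lower_upper_conj_diag_eq`.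
[cite: HarishChandra1970, Lemma 22] [cite: Casselman1995, Prop. 1.4.4] [cite: Rogawski1990, §12.5 p. 182] -/
theorem exists_conj_eq_lower_mul_torus_mul_upper (hσ : ∀ x, σ (σ x) = x) (hσc : Continuous σ)
    {t nb n : ↥(unitaryGroupOfForm σ J)} (ht : t ∈ torusU σ J)
    (hreg : σ (((t : GL (Fin 2) K) : Matrix (Fin 2) (Fin 2) K) 1 1) * ((t : GL (Fin 2) K) : Matrix (Fin 2) (Fin 2) K) 1 1 ≠ 1)
    {γ : ValueGroupWithZero K} (hγ1 : γ < 1)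
    (hγa : γ * valuation K (σ (((t : GL (Fin 2) K) : Matrix (Fin 2) (Fin 2) K) 1 1) * ((t : GL (Fin 2) K) : Matrix (Fin 2) (Fin 2) K) 1 1 - 1) ≤ 1)
    {Z : K} (hnb : ((nb : GL (Fin 2) K) : Matrix (Fin 2) (Fin 2) K) = !![1, 0; Z, 1])
    (hZ : valuation K Z ≤ γ * valuation K (σ (((t : GL (Fin 2) K) : Matrix (Fin 2) (Fin 2) K) 1 1) * ((t : GL (Fin 2) K) : Matrix (Fin 2) (Fin 2) K) 1 1 - 1))
    {Y : K} (hn : ((n : GL (Fin 2) K) : Matrix (Fin 2) (Fin 2) K) = !![1, Y; 0, 1])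
    (hY : valuation K Y ≤ γ * valuation K (σ (((t : GL (Fin 2) K) : Matrix (Fin 2) (Fin 2) K) 1 1) * ((t : GL (Fin 2) K) : Matrix (Fin 2) (Fin 2) K) 1 1 - 1)) :
    ∃ k : ↥(unitaryGroupOfForm σ J), (k : GL (Fin 2) K) ∈ congruenceGL 2 γ ∧
      ∃ τ : ↥(unitaryGroupOfForm σ J), τ ∈ torusU σ J ∧ (τ : GL (Fin 2) K) ∈ congruenceGL 2 γ ∧ k * (t * τ) * k⁻¹ = nb * t * n := by
  have hγ1' : γ ≤ 1 := hγ1.le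
  obtain ⟨h01, h10⟩ := map_entry_mul_entry_eq_one_of_mem_torusU σ hJ ht
  have htm := coe_eq_diag_of_mem_torusU σ ht
  set e₀ : K := ((t : GL (Fin 2) K) : Matrix (Fin 2) (Fin 2) K) 0 0 with he₀def
  set e₁ : K := ((t : GL (Fin 2) K) : Matrix (Fin 2) (Fin 2) K) 1 1 with he₁def
  have he₀ : e₀ ≠ 0 := fun h => by rw [h, mul_zero] at h10; exact zero_ne_one h10
  have he₁ : e₁ ≠ 0 := fun h => by rw [h, mul_zero] at h01; exact zero_ne_one h01
  set ai : K := σ e₁ * e₁ with hai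
  have hai' : ai = e₁ / e₀ := by
    rw [eq_div_iff he₀, hai, mul_assoc, mul_comm e₁ e₀, ← mul_assoc, h10, one_mul]
  have he₁' : e₁ = ai * e₀ := by rw [hai', div_mul_cancel₀ _ he₀]
  have haiσ : σ ai = ai := by rw [hai, map_mul, hσ, mul_comm]
  have hai1 : ai - 1 ≠ 0 := sub_ne_zero.2 hreg
  have hvai : 0 < valuation K (ai - 1) := zero_lt_iff.2 ((Valuation.ne_zero_iff _).2 hai1)
  have hZσ : σ Z = -Z := by
    obtain ⟨h00, -, -, -⟩ := (mem_unitaryGroupOfForm_two_iff σ hJ (nb : GL (Fin 2) K)).1 nb.2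
    rw [hnb] at h00; simp at h00; linear_combination h00
  have hYσ : σ Y = -Y := by
    obtain ⟨-, -, -, h11⟩ := (mem_unitaryGroupOfForm_two_iff σ hJ (n : GL (Fin 2) K)).1 n.2
    rw [hn] at h11; simp at h11; linear_combination h11
  have hγai : γ * valuation K (ai - 1) ≤ 1 := hγa
  have hγv : γ * valuation K (ai - 1) < valuation K (ai - 1) := by simpa only [one_mul] using mul_lt_mul_of_pos_right hγ1 hvai
  have hZY : valuation K (Z * Y) < valuation K (ai - 1) := by
    rw [map_mul]; exact ((mul_le_mul' hZ hY).trans ((mul_le_mul' hγai le_rfl).trans_eq (one_mul _))).trans_lt hγv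
  set c : K := 1 - ai - Z * Y with hc
  have hvc : valuation K c = valuation K (ai - 1) := by
    have h1 : valuation K (1 - ai) = valuation K (ai - 1) := Valuation.map_sub_swap _ _ _
    rw [hc, ← h1]
    exact Valuation.map_sub_eq_of_lt_left _ (by rw [h1]; exact hZY)
  have hc0 : c ≠ 0 := (Valuation.ne_zero_iff _).1 (by rw [hvc]; exact hvai.ne')
  have hcσ : σ c = c := by rw [hc, map_sub, map_sub, map_one, haiσ, map_mul, hZσ, hYσ, neg_mul_neg]
  obtain ⟨z, hzσ, hzv, hzeq⟩ := exists_skew_root σ hσc hγ1 hc0 hcσ hYσ hZσ (by rw [hvc]; exact hY) (by rw [hvc]; exact hZ)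
  set β : K := 1 + Y * z with hβ
  have hYz : valuation K (Y * z) ≤ γ := by
    rw [map_mul]; exact (mul_le_mul' hY hzv).trans ((mul_le_mul' hγai le_rfl).trans_eq (one_mul γ))
  have hYzai : valuation K (Y * z) < valuation K (ai - 1) := by
    rw [map_mul]; exact ((mul_le_mul' hY hzv).trans ((mul_le_mul' le_rfl hγ1').trans_eq (mul_one _))).trans_lt hγv
  obtain ⟨hβv, hβ0⟩ : valuation K β = 1 ∧ β ≠ 0 := valuation_one_add_eq_one (hYz.trans_lt hγ1)
  have hβσ : σ β = β := by rw [hβ, map_add, map_one, map_mul, hYσ, hzσ, neg_mul_neg]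
  have hβ1 : valuation K (β - 1) ≤ γ := by rw [hβ, add_sub_cancel_left]; exact hYz
  have hβi1 : valuation K (β⁻¹ - 1) ≤ γ := by
    have : β⁻¹ - 1 = -(β - 1) / β := by field_simp; ring
    rw [this, map_div₀, Valuation.map_neg, hβv, div_one]; exact hβ1
  have hβvi : valuation K β⁻¹ = 1 := by rw [map_inv₀, hβv, inv_one]
  have hβsq : valuation K (β ^ 2 - 1) < valuation K (ai - 1) := by
    have hfac : β ^ 2 - 1 = (Y * z) * (β + 1) := by rw [hβ]; ring
    rw [hfac, map_mul]
    calc valuation K (Y * z) * valuation K (β + 1) ≤ valuation K (Y * z) * 1 :=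
          mul_le_mul' le_rfl (le_trans (Valuation.map_add _ _ _) (max_le hβv.le (Valuation.map_one _).le))
      _ = valuation K (Y * z) := mul_one _
      _ < valuation K (ai - 1) := hYzai
  have hvE : valuation K (ai - β ^ 2) = valuation K (ai - 1) := by
    have : ai - β ^ 2 = (ai - 1) - (β ^ 2 - 1) := by ring
    rw [this]
    exact Valuation.map_sub_eq_of_lt_left _ hβsq
  have hE0 : ai - β ^ 2 ≠ 0 := (Valuation.ne_zero_iff _).1 (by rw [hvE]; exact hvai.ne')
  have hE : e₁ - e₀ * β ^ 2 ≠ 0 := by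
    have : e₁ - e₀ * β ^ 2 = e₀ * (ai - β ^ 2) := by rw [he₁']; ring
    rw [this]; exact mul_ne_zero he₀ hE0
  set y : K := Y * β / (ai - β ^ 2) with hy
  have hy' : y = Y * e₀ * β / (e₁ - e₀ * β ^ 2) := by
    have hden : ai * e₀ - e₀ * β ^ 2 ≠ 0 := by
      have : ai * e₀ - e₀ * β ^ 2 = e₀ * (ai - β ^ 2) := by ring
      rw [this]; exact mul_ne_zero he₀ hE0
    rw [hy, he₁', div_eq_div_iff hE0 hden]
    ring
  have hyσ : σ y = -y := by
    rw [hy, map_div₀, map_mul, map_sub, map_pow, hYσ, hβσ, haiσ, neg_mul, neg_div]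
  have hyv : valuation K y ≤ γ := by
    rw [hy, map_div₀, map_mul, hβv, mul_one, hvE, div_le_iff₀ hvai]; exact hY
  obtain ⟨L, hL, hLi⟩ := exists_lower σ hJ (show z + σ z = 0 by rw [hzσ, add_neg_cancel])
  obtain ⟨U, hU, hUi⟩ := exists_upper σ hJ (show y + σ y = 0 by rw [hyσ, add_neg_cancel])
  obtain ⟨D, hD, hDi⟩ := exists_diag σ hJ (d := β) (e := β⁻¹) (by rw [hβσ, mul_inv_cancel₀ hβ0]) (by rw [map_inv₀, hβσ, inv_mul_cancel₀ hβ0])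
  rw [map_inv₀, hβσ] at hDi
  refine ⟨L * U, ?_, D, ?_, ?_, ?_⟩
  · -- `k = ū(z) u(y) ∈ K_γ`
    rw [Subgroup.coe_mul]
    exact Subgroup.mul_mem _ (lower_mem_congruenceGL hγ1' hzv hL hLi) (upper_mem_congruenceGL hγ1' hyv hU hUi)
  · -- `τ = m(β, β⁻¹) ∈ M`
    rw [mem_torusU_iff]
    refine ⟨![Units.mk0 β hβ0, Units.mk0 β⁻¹ (inv_ne_zero hβ0)], Units.ext ?_⟩
    rw [coe_glDiagonal, hD]
    ext i j; fin_cases i <;> fin_cases j <;> simp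
  · -- `τ ∈ K_γ`
    exact diag_mem_congruenceGL hβv.le hβvi.le hβvi.le hβv.le hβ1 hβi1 hβi1 hβ1 hD hDi
  · -- the identity
    apply Subtype.ext
    simp only [Subgroup.coe_mul, InvMemClass.coe_inv, _root_.mul_inv_rev]
    apply Units.ext
    simp only [Units.val_mul, hL, hU, htm, hD, hUi, hLi, hnb, hn]
    have hdiag : (!![e₀, 0; 0, e₁] : Matrix (Fin 2) (Fin 2) K) * !![β, 0; 0, β⁻¹] = !![e₀ * β, 0; 0, e₁ * β⁻¹] := by
      simp only [Matrix.mul_fin_two, mul_zero, zero_mul, add_zero, zero_add]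
    have hZ' : Z = ((e₀ - e₁) * z + e₀ * Y * z ^ 2) / (e₀ * β) := by
      rw [eq_div_iff (mul_ne_zero he₀ hβ0), he₁', hβ]
      have : c * z + Y * z ^ 2 = Z := hzeq
      rw [hc] at this
      linear_combination (-e₀) * this
    rw [hdiag]
    exact lower_upper_conj_diag_eq Y z y Z e₀ e₁ β hβ hβ0 he₀ hE hy' hZ'

/-! ## §5 The (B5)-shaped corollary: `s · (n̄ m n) ∈ Ad(K_γ)(s · M_γ)` for the REGULAR base point `s` of the tube -/

include hJ in
/-- **(B6) ORBIT-TUBE₂ «⊇» in the letters of (B5) «ORBIT-TUBE₂ ⊆»** (convention `N̄·M·N`, bare product, `a := s₀₀·σ(s₀₀)` the root value of the base point `s ∈ M`):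
for `s` REGULAR (`a ≠ 1`), `γ < 1`, `γ < |a − 1|` (regularity margin), `γ·|a⁻¹ − 1| ≤ 1`, every `s · (n̄ · m · n)` with `n̄ = !![1, 0; Z, 1]`, `|Z| ≤ γ|a − 1|`, `m ∈ M ∩ K_γ`,
`n = !![1, Y; 0, 1]`, `|Y| ≤ γ|a⁻¹ − 1|` (all in `U′`) is `k · (s τ) · k⁻¹` with `k ∈ U′ ∩ K_γ`, `τ ∈ M ∩ K_γ`: **`s · P_s ⊆ Ad(K_γ)(s · M_γ)`** for
`P_s = N̄[γ|a−1|] · M_γ · N[γ|a⁻¹−1|]`.  Reduction to `exists_conj_eq_lower_mul_torus_mul_upper` at `t := s m`: `s · ū(Z) = ū(a⁻¹Z) · s` (★ (B1) §4) and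
`|a(t)⁻¹ − 1| = |a⁻¹ − 1|` because `|a(m) − 1| ≤ γ < |a − 1|`. [cite: HarishChandra1970, Lemma 22] [cite: Casselman1995, Prop. 1.4.4] [cite: Rogawski1990, §12.5 p. 182] -/
theorem exists_conj_eq_torus_mul_lower_mul_torus_mul_upper (hσ : ∀ x, σ (σ x) = x) (hσc : Continuous σ)
    {s nb m n : ↥(unitaryGroupOfForm σ J)} (hs : s ∈ torusU σ J) (hm : m ∈ torusU σ J) {γ : ValueGroupWithZero K}
    (hmK : (m : GL (Fin 2) K) ∈ congruenceGL 2 γ)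
    (ha1 : ((s : GL (Fin 2) K) : Matrix (Fin 2) (Fin 2) K) 0 0 * σ (((s : GL (Fin 2) K) : Matrix (Fin 2) (Fin 2) K) 0 0) ≠ 1) (hγ : γ < 1)
    (hγ2 : γ < valuation K (((s : GL (Fin 2) K) : Matrix (Fin 2) (Fin 2) K) 0 0 * σ (((s : GL (Fin 2) K) : Matrix (Fin 2) (Fin 2) K) 0 0) - 1))
    (hγ3 : γ * valuation K ((((s : GL (Fin 2) K) : Matrix (Fin 2) (Fin 2) K) 0 0 * σ (((s : GL (Fin 2) K) : Matrix (Fin 2) (Fin 2) K) 0 0))⁻¹ - 1) ≤ 1)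
    {Z : K} (hnb : ((nb : GL (Fin 2) K) : Matrix (Fin 2) (Fin 2) K) = !![1, 0; Z, 1])
    (hZ : valuation K Z ≤ γ * valuation K (((s : GL (Fin 2) K) : Matrix (Fin 2) (Fin 2) K) 0 0 * σ (((s : GL (Fin 2) K) : Matrix (Fin 2) (Fin 2) K) 0 0) - 1))
    {Y : K} (hn : ((n : GL (Fin 2) K) : Matrix (Fin 2) (Fin 2) K) = !![1, Y; 0, 1])
    (hY : valuation K Y ≤ γ * valuation K ((((s : GL (Fin 2) K) : Matrix (Fin 2) (Fin 2) K) 0 0 * σ (((s : GL (Fin 2) K) : Matrix (Fin 2) (Fin 2) K) 0 0))⁻¹ - 1)) :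
    ∃ k : ↥(unitaryGroupOfForm σ J), (k : GL (Fin 2) K) ∈ congruenceGL 2 γ ∧
      ∃ τ : ↥(unitaryGroupOfForm σ J), τ ∈ torusU σ J ∧ (τ : GL (Fin 2) K) ∈ congruenceGL 2 γ ∧ k * (s * τ) * k⁻¹ = s * (nb * m * n) := by
  obtain ⟨hs01, hs10⟩ := map_entry_mul_entry_eq_one_of_mem_torusU σ hJ hs
  obtain ⟨hm01, hm10⟩ := map_entry_mul_entry_eq_one_of_mem_torusU σ hJ hm
  have hsm := coe_eq_diag_of_mem_torusU σ hs
  have hmm := coe_eq_diag_of_mem_torusU σ hm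
  have hmi := coe_inv_eq_of_mem σ hJ m.2
  have hsi := coe_inv_eq_of_mem σ hJ s.2
  set d₀ : K := ((s : GL (Fin 2) K) : Matrix (Fin 2) (Fin 2) K) 0 0 with hd₀
  set d₁ : K := ((s : GL (Fin 2) K) : Matrix (Fin 2) (Fin 2) K) 1 1 with hd₁
  set u₀ : K := ((m : GL (Fin 2) K) : Matrix (Fin 2) (Fin 2) K) 0 0 with hu₀
  set u₁ : K := ((m : GL (Fin 2) K) : Matrix (Fin 2) (Fin 2) K) 1 1 with hu₁
  have hs10' : ((s : GL (Fin 2) K) : Matrix (Fin 2) (Fin 2) K) 1 0 = 0 := by rw [hsm]; simp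
  have hs01' : ((s : GL (Fin 2) K) : Matrix (Fin 2) (Fin 2) K) 0 1 = 0 := by rw [hsm]; simp
  have hm10' : ((m : GL (Fin 2) K) : Matrix (Fin 2) (Fin 2) K) 1 0 = 0 := by rw [hmm]; simp
  have hm01' : ((m : GL (Fin 2) K) : Matrix (Fin 2) (Fin 2) K) 0 1 = 0 := by rw [hmm]; simp
  rw [hs10', hs01', map_zero] at hsi
  rw [hm10', hm01', map_zero] at hmi
  have hd₀ne : d₀ ≠ 0 := fun h => by rw [h, mul_zero] at hs10; exact zero_ne_one hs10
  set a : K := d₀ * σ d₀ with ha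
  have ha0 : a ≠ 0 := mul_ne_zero hd₀ne (fun h => by rw [h, zero_mul] at hs01; exact zero_ne_one hs01)
  have hai : σ d₁ * d₁ = a⁻¹ := by
    refine (eq_inv_of_mul_eq_one_left ?_)
    calc σ d₁ * d₁ * a = (σ d₁ * d₀) * (σ d₀ * d₁) := by rw [ha]; ring
      _ = 1 := by rw [hs10, hs01, mul_one]
  have hva : 0 < valuation K a := zero_lt_iff.2 ((Valuation.ne_zero_iff _).2 ha0)
  have hvai1 : valuation K (a⁻¹ - 1) = valuation K a⁻¹ * valuation K (a - 1) := by
    rw [← map_mul, show a⁻¹ * (a - 1) = -(a⁻¹ - 1) by field_simp; ring, Valuation.map_neg]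
  have ha1' : a - 1 ≠ 0 := sub_ne_zero.2 ha1
  have hva1 : 0 < valuation K (a - 1) := zero_lt_iff.2 ((Valuation.ne_zero_iff _).2 ha1')
  obtain ⟨⟨-, hmi1⟩, hmγ, hmiγ⟩ := mem_congruenceGL_iff.1 hmK
  have hu₁1 : valuation K (u₁ - 1) ≤ γ := by
    have := hmγ 1 1; rwa [Matrix.sub_apply, Matrix.one_apply_eq] at this
  have hσu₁ : valuation K (σ u₁) ≤ 1 := by
    have := hmi1 0 0; rw [hmi] at this; simpa using this
  have hσu₁1 : valuation K (σ u₁ - 1) ≤ γ := by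
    have := hmiγ 0 0; rw [Matrix.sub_apply, hmi, Matrix.one_apply_eq] at this; simpa using this
  set b : K := σ u₁ * u₁ with hb
  have hb1 : valuation K (b - 1) ≤ γ := by
    have : b - 1 = σ u₁ * (u₁ - 1) + (σ u₁ - 1) := by rw [hb]; ring
    rw [this]
    refine le_trans (Valuation.map_add _ _ _) (max_le ?_ hσu₁1)
    rw [map_mul]
    calc valuation K (σ u₁) * valuation K (u₁ - 1) ≤ 1 * γ := mul_le_mul' hσu₁ hu₁1
      _ = γ := one_mul γ
  have ht : s * m ∈ torusU σ J := Subgroup.mul_mem _ hs hm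
  have ht11 : ((((s * m : ↥(unitaryGroupOfForm σ J)) : GL (Fin 2) K) : Matrix (Fin 2) (Fin 2) K) 1 1) = d₁ * u₁ := by
    rw [Subgroup.coe_mul, Units.val_mul, hsm, hmm]; simp
  have hati : σ (d₁ * u₁) * (d₁ * u₁) = a⁻¹ * b := by rw [map_mul, ← hai, hb]; ring
  have hkey : valuation K (a⁻¹ * b - 1) = valuation K (a⁻¹ - 1) := by
    have : a⁻¹ * b - 1 = a⁻¹ * (b - 1) + (a⁻¹ - 1) := by ring
    have hvainv : 0 < valuation K a⁻¹ := zero_lt_iff.2 ((Valuation.ne_zero_iff _).2 (inv_ne_zero ha0))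
    have hlt : valuation K (a⁻¹ * (b - 1)) < valuation K (a⁻¹ - 1) := by
      rw [map_mul, hvai1]
      exact mul_lt_mul_of_pos_left (hb1.trans_lt hγ2) hvainv
    rw [this]
    exact Valuation.map_add_eq_of_lt_right _ hlt
  have hreg' : σ (d₁ * u₁) * (d₁ * u₁) ≠ 1 := by
    intro h
    have : valuation K (a⁻¹ * b - 1) = 0 := by rw [← hati, h, sub_self, Valuation.map_zero]
    rw [hkey, hvai1] at this
    exact (mul_ne_zero ((Valuation.ne_zero_iff _).2 (inv_ne_zero ha0)) hva1.ne') this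
  have hnb' : ((((s * nb * s⁻¹ : ↥(unitaryGroupOfForm σ J)) : GL (Fin 2) K) : Matrix (Fin 2) (Fin 2) K)) = !![1, 0; a⁻¹ * Z, 1] := by
    have h := coe_inv_mul_mul_of_mem_torusU_of_eq_lower σ hJ (m := s⁻¹) (n := nb) (Subgroup.inv_mem _ hs) hnb
    rw [inv_inv] at h
    rw [h]
    have e00 : (((s⁻¹ : ↥(unitaryGroupOfForm σ J)) : GL (Fin 2) K) : Matrix (Fin 2) (Fin 2) K) 0 0 = σ d₁ := by
      rw [InvMemClass.coe_inv, hsi]; simp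
    rw [e00, hσ, ← hai, show d₁ * Z * σ d₁ = σ d₁ * d₁ * Z by ring]
  have hZ' : valuation K (a⁻¹ * Z) ≤ γ * valuation K (σ (d₁ * u₁) * (d₁ * u₁) - 1) := by
    rw [hati, hkey, hvai1, map_mul]
    calc valuation K a⁻¹ * valuation K Z ≤ valuation K a⁻¹ * (γ * valuation K (a - 1)) := mul_le_mul' le_rfl hZ
      _ = γ * (valuation K a⁻¹ * valuation K (a - 1)) := mul_left_comm _ _ _
  have hY' : valuation K Y ≤ γ * valuation K (σ (d₁ * u₁) * (d₁ * u₁) - 1) := by rw [hati, hkey]; exact hY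
  have hγa' : γ * valuation K (σ (d₁ * u₁) * (d₁ * u₁) - 1) ≤ 1 := by rw [hati, hkey]; exact hγ3
  obtain ⟨k, hk, τ, hτ, hτK, hconj⟩ := exists_conj_eq_lower_mul_torus_mul_upper σ hJ hσ hσc (t := s * m) (nb := s * nb * s⁻¹) (n := n) ht
    (by rw [ht11]; exact hreg') hγ (by rw [ht11]; exact hγa') hnb' (by rw [ht11]; exact hZ') hn (by rw [ht11]; exact hY')
  refine ⟨k, hk, m * τ, Subgroup.mul_mem _ hm hτ, ?_, ?_⟩
  · rw [Subgroup.coe_mul]; exact Subgroup.mul_mem _ hmK hτK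
  · calc k * (s * (m * τ)) * k⁻¹ = k * (s * m * τ) * k⁻¹ := by rw [mul_assoc s m τ]
      _ = s * nb * s⁻¹ * (s * m) * n := hconj
      _ = s * (nb * m * n) := by group

end Main

end Summit.HodgeConjecture.HodgeConjecture.Cruxes.H413.F0P3cStCharTSUpTrU2OrbitSurj
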